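import Literature.Computability.MetaComplexity.GapMINKTNWParams
import Literature.Computability.Complexity.CoinChunks
import Literature.Computability.Complexity.CountingHierarchyProofs
import HarnessLib

/-!
# The randomised test of the Gap-MINKT decision procedure: seven NW samples against the dense set of random strings

Topic `Literature/Computability/MetaComplexity`. The `Promise-BPP` core of the tree's route to Hirahara's
Cor. 4.23 (FOCS 2018 / ECCC TR18-138; the derandomisation by `Promise-BPP = Promise-P` under
`DistNP ⊆ AvgP` is Buhrman–Fortnow–Pavan, as in the printed proof of Cor. 4.23): on `⟨x, 1ᵗ, 1ˢ⟩` the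
test draws seven seeds `z ∈ {0,1}^d` and ACCEPTS iff no output `NW^{Enc(x)}(z)` lies in the slice `T_{t₁}`
of the dense language `T ∈ P` of `(n−1)`-random strings (Lemma 4.17). Yes-instances are accepted with
probability one (Lemma 4.10: the outputs are compressible, hence outside `T_{t₁}`), and if the outputs hit
`T_{t₁}` with probability `≥ 1/6` the test rejects with probability `≥ 1 − (5/6)⁷ ≥ 2/3`:

* `NWSamp.uniformProb_forall_blocks` — independence of disjoint coin blocks:
  `Pr_{w ∈ {0,1}^{K d}}[∀ k < K, block_k(w) ∈ E] = Pr_{z ∈ {0,1}^d}[z ∈ E]^K`;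
* `NWSamp.samplerF c TL` (the test as a one-bit `FP` function of `⟨instance, coins⟩`, built from the
  parameter bricks of `GapMINKTNWParams.lean` and `NWLine.nwEvalF`), `samplerF_apply`, `samplerF_mem_FP`,
  `NWSamp.lang c TL ∈ P` (`lang_mem_P`);
* `NWSamp.prob_yes`, `NWSamp.prob_no` — the two acceptance bounds in the shape of `PromiseBPP'`.

## References

* S. Hirahara, ECCC TR18-138 (2018), Lemma 4.10, Lemma 4.17, Thm. 4.21 (proof), Cor. 4.22, Cor. 4.23.
* H. Buhrman, L. Fortnow, A. Pavan, *Some results on derandomization*, Theory Comput. Syst. 38 (2005), Thm. 3.1.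
* S. Arora, B. Barak, CUP 2009, §7.1, §7.4.1 (error reduction by repetition), §A.2.
-/

noncomputable section

namespace Literature.Computability.MetaComplexity

open _root_.Computability Polynomial Complexity Complexity.Brick Complexity.Plumb Complexity.OracleCompose Complexity.HashBricks Finset

namespace NWSamp

/-! ### Independence of disjoint coin blocks -/

/-- **`Pr_{w ∈ {0,1}^{K d}}[∀ k < K, (w ⇂ k d) ↾ d ∈ E] = Pr_{z ∈ {0,1}^d}[z ∈ E]^K`.**
[cite: AroraBarak2009, §A.2] -/
theorem uniformProb_forall_blocks (K d : ℕ) (E : Set (List Bool)) :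
    uniformProb (K * d) {w | ∀ k < K, (w.drop (k * d)).take d ∈ E} = uniformProb d E ^ K := by
  classical
  set S : Finset (List.Vector Bool d) := univ.filter fun v => v.toList ∈ E with hS
  have hE : uniformProb d E = (S.card : ℝ) / 2 ^ d := rfl
  have hcongr : uniformProb (K * d) {w | ∀ k < K, (w.drop (k * d)).take d ∈ E} =
      uniformProb (K * d) {w | ∃ h : w.length = K * d, ∀ k : Fin K, (chunkVec ⟨w, h⟩ k).toList ∈ E} := by
    rw [uniformProb_eq_cnt_div, uniformProb_eq_cnt_div, cnt_congr]
    intro y hy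
    simp only [Set.mem_setOf_eq]
    constructor
    · intro h; exact ⟨hy, fun k => h k k.isLt⟩
    · rintro ⟨h, hk⟩ k hkK; exact hk ⟨k, hkK⟩
  rw [hcongr, uniformProb_eq_card_of_bijective _ (chunkVec_bijective K d) (fun g : Fin K → List.Vector Bool d => ∀ k, (g k).toList ∈ E)]
  rw [show (univ.filter fun g : Fin K → List.Vector Bool d => ∀ k, (g k).toList ∈ E) = Fintype.piFinset fun _ : Fin K => S by
      ext g; simp [hS, Fintype.mem_piFinset],
    Fintype.card_piFinset_const, Fintype.card_pi_const, card_vector, Fintype.card_bool, hE]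
  push_cast
  rw [div_pow]

/-! ### The test -/

section Test

variable (c : NWPar.Cfg) (TL : Language Bool)

/-- The instance from `⟨⟨inst, coins⟩, 1ᵏ⟩`. [folklore] -/
def II : List Bool → List Bool := fstF ∘ fstF
/-- Seed block `k`: `(coins ⇂ k d) ↾ d`. [folklore] -/
def zK : List Bool → List Bool := takeFn ∘ fanoutFn (c.dF ∘ II) (dropFn ∘ fanoutFn (umulFn ∘ fanoutFn sndF (c.dF ∘ II)) (sndF ∘ fstF))
/-- The NW output on seed block `k`. [cite: Hirahara2018, Thm. 4.21 (proof)] -/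
def yK : List Bool → List Bool :=
  NWLine.nwEvalF ∘ fanoutFn (fanoutFn (c.fF ∘ II) (zK c)) (fanoutFn (c.qF ∘ II) (fanoutFn (c.lF ∘ II) (c.mF ∘ II)))
/-- The one-bit test of block `k`: the output is OUTSIDE the slice `T_{t₁}`. [cite: Hirahara2018, Thm. 4.21 (proof)] -/
def okK : List Bool → List Bool := notFn (Oracle.ofLanguage TL ∘ fanoutFn (yK c) (c.t1F ∘ II))
/-- **The test**: all seven blocks pass. [cite: AroraBarak2009, §7.4.1] -/
def samplerF : List Bool → List Bool := allIdxFn (fun _ => ones 7) (okK c TL)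

/-- `okK` is one-bit. [folklore] -/
theorem oneBit_okK : OneBit (okK c TL) := oneBit_notFn ((GuardedBall.oneBit_ofLanguage TL).comp _)

/-- The NW output of the procedure on seed `z`: `NW^{f}(z)` on the design of lines with the parameters
of the instance. [cite: Hirahara2018, Thm. 4.21 (proof)] -/
def yOf (x : List Bool) (s : ℕ) (z : List Bool) : List Bool :=
  NWStr.nwOut (c.qOf x s) (c.fOf x) (LineDesign.lineDesign (c.qOf x s) (c.ellOf x) (c.mOf x s)) z

/-- **The language of the test** `{z | samplerF z = [1]}`. [cite: Goldreich2006, Def. 1.2 (promise-BPP)] -/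
def lang : Language Bool := {z | samplerF c TL z = [true]}

end Test

section Facts

variable {c : NWPar.Cfg} {TL : Language Bool}

/-- `zK` is polynomial-time computable (`FP`). [folklore] -/
theorem zK_mem_FP (henc : c.enc ∈ FP) : zK c ∈ FP :=
  comp_mem_FP takeFn_mem_FP (fanoutFn_mem_FP (comp_mem_FP (NWPar.Cfg.dF_mem_FP henc) (comp_mem_FP fstF_mem_FP fstF_mem_FP))
    (comp_mem_FP dropFn_mem_FP (fanoutFn_mem_FP (comp_mem_FP umulFn_mem_FP (fanoutFn_mem_FP sndF_mem_FP
      (comp_mem_FP (NWPar.Cfg.dF_mem_FP henc) (comp_mem_FP fstF_mem_FP fstF_mem_FP)))) (comp_mem_FP sndF_mem_FP fstF_mem_FP))))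

/-- `yK` is polynomial-time computable (`FP`). [folklore] -/
theorem yK_mem_FP (henc : c.enc ∈ FP) : yK c ∈ FP := by
  have hII : II ∈ FP := comp_mem_FP fstF_mem_FP fstF_mem_FP
  exact comp_mem_FP NWLine.nwEvalF_mem_FP (fanoutFn_mem_FP (fanoutFn_mem_FP (comp_mem_FP (NWPar.Cfg.fF_mem_FP henc) hII) (zK_mem_FP henc))
    (fanoutFn_mem_FP (comp_mem_FP (NWPar.Cfg.qF_mem_FP henc) hII) (fanoutFn_mem_FP (comp_mem_FP (NWPar.Cfg.lF_mem_FP henc) hII)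
      (comp_mem_FP (NWPar.Cfg.mF_mem_FP henc) hII))))

/-- `okK` is polynomial-time computable (`FP`). [folklore] -/
theorem okK_mem_FP (henc : c.enc ∈ FP) (hTL : TL ∈ Classes.P) : okK c TL ∈ FP :=
  notFn_mem_FP (comp_mem_FP (GuardedBall.ofLanguage_mem_FP_of_mem_P hTL) (fanoutFn_mem_FP (yK_mem_FP henc)
    (comp_mem_FP NWPar.Cfg.t1F_mem_FP (comp_mem_FP fstF_mem_FP fstF_mem_FP))))

/-- **The test is in `FP`** for `enc ∈ FP`, `T ∈ P`. [cite: Hirahara2018, Thm. 4.21 (proof: "a randomized polynomial-time algorithm")] -/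
theorem samplerF_mem_FP (henc : c.enc ∈ FP) (hTL : TL ∈ Classes.P) : samplerF c TL ∈ FP :=
  allIdxFn_mem_FP (const_mem_FP _) (okK_mem_FP henc hTL) (oneBit_okK c TL)

/-- **The language of the test is in `P`.** [cite: Hirahara2018, Thm. 4.21 (proof)] -/
theorem lang_mem_P (henc : c.enc ∈ FP) (hTL : TL ∈ Classes.P) : lang c TL ∈ Classes.P :=
  setOf_apply_eq_apply_mem_P (samplerF_mem_FP henc hTL) (const_mem_FP [true])

open Classical in
/-- **Value of the test** on `⟨⟨x, 1ᵗ, 1ˢ⟩, coins⟩` (given room for the ruler): all seven outputs on the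
coin blocks avoid the slice `T_{t₁}`. [cite: Hirahara2018, Thm. 4.21 (proof)] -/
theorem samplerF_apply (c : NWPar.Cfg) (TL : Language Bool) {x : List Bool} {t s : ℕ} (hR : c.TOf x.length t ≤ c.Rpoly.eval (c.VOf x.length t))
    (coins : List Bool) :
    samplerF c TL (boolPair (NWPar.inst x t s) coins) =
      [decide (∀ k < 7, boolPair (yOf c x s ((coins.drop (k * c.dOf x s)).take (c.dOf x s))) (ones (c.t1Of x.length t)) ∉ TL)] := by
  rw [samplerF, allIdxFn_apply (oneBit_okK c TL) (by simp only [length_boolPair, NWPar.inst, List.length_replicate]; omega)]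
  simp only [List.length_replicate]
  congr 1
  rw [decide_eq_decide]
  refine forall₂_congr fun k _ => ?_
  have hy : yK c (boolPair (boolPair (NWPar.inst x t s) coins) (ones k)) = yOf c x s ((coins.drop (k * c.dOf x s)).take (c.dOf x s)) := by
    simp only [yK, zK, II, Function.comp_apply, fanoutFn_apply, fstF_boolPair, sndF_boolPair, NWPar.Cfg.fF_inst, NWPar.Cfg.dF_inst, NWPar.Cfg.qF_inst,
      NWPar.Cfg.lF_inst, NWPar.Cfg.mF_inst, umulFn_boolPair, dropFn_boolPair, takeFn_boolPair, List.length_replicate]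
    exact NWLine.nwEvalF_apply _ _ _ _ _
  have hok : okK c TL (boolPair (boolPair (NWPar.inst x t s) coins) (ones k)) =
      [!decide (boolPair (yOf c x s ((coins.drop (k * c.dOf x s)).take (c.dOf x s))) (ones (c.t1Of x.length t)) ∈ TL)] := by
    rw [okK, notFn_apply]
    simp only [Function.comp_apply, fanoutFn_apply, hy, II, fstF_boolPair, NWPar.Cfg.t1F_inst c hR, GuardedBall.ofLanguage_apply_decide]
  rw [hok]
  simp

/-- Membership in the language of the test, on genuine arguments. [folklore] -/
theorem boolPair_mem_lang_iff (c : NWPar.Cfg) (TL : Language Bool) {x : List Bool} {t s : ℕ} (hR : c.TOf x.length t ≤ c.Rpoly.eval (c.VOf x.length t))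
    (coins : List Bool) :
    boolPair (NWPar.inst x t s) coins ∈ lang c TL ↔
      ∀ k < 7, boolPair (yOf c x s ((coins.drop (k * c.dOf x s)).take (c.dOf x s))) (ones (c.t1Of x.length t)) ∉ TL := by
  classical
  change samplerF c TL (boolPair (NWPar.inst x t s) coins) = [true] ↔ _
  rw [samplerF_apply c TL hR]
  simp

/-! ### The two acceptance bounds -/

/-- **Yes side**: if every output on a seed of length `d` avoids the slice, the test accepts ALL coin strings
of any length `≥ 7d`. [cite: Hirahara2018, Thm. 4.21 (proof)] -/
theorem prob_yes (c : NWPar.Cfg) (TL : Language Bool) {x : List Bool} {t s : ℕ} (hR : c.TOf x.length t ≤ c.Rpoly.eval (c.VOf x.length t))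
    {L : ℕ} (hL : 7 * c.dOf x s ≤ L)
    (h : ∀ z : List Bool, z.length = c.dOf x s → boolPair (yOf c x s z) (ones (c.t1Of x.length t)) ∉ TL) :
    uniformProb L {coins | boolPair (NWPar.inst x t s) coins ∈ lang c TL} = 1 := by
  rw [uniformProb_eq_cnt_div, cnt_eq_two_pow_of_forall (fun coins hlen => ?_)]
  · simp
  · rw [Set.mem_setOf_eq, boolPair_mem_lang_iff c TL hR]
    intro k hk
    apply h
    rw [List.length_take, List.length_drop, hlen, min_eq_left]
    have : (k + 1) * c.dOf x s ≤ 7 * c.dOf x s := Nat.mul_le_mul_right _ hk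
    rw [Nat.succ_mul] at this
    omega

/-- `(5/6)⁷ ≤ 1/3`. [folklore] -/
theorem five_sixth_pow_seven_le : ((5 : ℝ) / 6) ^ 7 ≤ 1 / 3 := by norm_num

/-- **No side**: if the outputs hit the slice with probability `≥ 1/6`, the test rejects with probability
`≥ 1 − (5/6)⁷ ≥ 2/3` over coin strings of any length `≥ 7d`. [cite: AroraBarak2009, §7.4.1 (error reduction)] -/
theorem prob_no (c : NWPar.Cfg) (TL : Language Bool) {x : List Bool} {t s : ℕ} (hR : c.TOf x.length t ≤ c.Rpoly.eval (c.VOf x.length t))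
    {L : ℕ} (hL : 7 * c.dOf x s ≤ L)
    (h : 1 / 6 ≤ uniformProb (c.dOf x s) {z | boolPair (yOf c x s z) (ones (c.t1Of x.length t)) ∈ TL}) :
    2 / 3 ≤ uniformProb L {coins | boolPair (NWPar.inst x t s) coins ∉ lang c TL} := by
  set d := c.dOf x s with hd
  set E : Set (List Bool) := {z | boolPair (yOf c x s z) (ones (c.t1Of x.length t)) ∉ TL} with hE
  -- the acceptance event depends on the first `7d` coins and factors over the blocks
  have hacc : uniformProb L {coins | boolPair (NWPar.inst x t s) coins ∈ lang c TL} = uniformProb d E ^ 7 := by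
    have h1 : {coins | boolPair (NWPar.inst x t s) coins ∈ lang c TL} = {coins | coins.take (7 * d) ∈ {w | ∀ k < 7, (w.drop (k * d)).take d ∈ E}} := by
      ext coins
      rw [Set.mem_setOf_eq, boolPair_mem_lang_iff c TL hR, Set.mem_setOf_eq, Set.mem_setOf_eq]
      refine forall₂_congr fun k hk => ?_
      rw [hE, Set.mem_setOf_eq, ← hd, List.drop_take, List.take_take, min_eq_left]
      have : (k + 1) * d ≤ 7 * d := Nat.mul_le_mul_right _ hk
      rw [Nat.succ_mul] at this; omega
    rw [h1, uniformProb_take_of_le hL, uniformProb_forall_blocks]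
  have hE6 : uniformProb d E ≤ 5 / 6 := by
    have hc := uniformProb_compl d {z | boolPair (yOf c x s z) (ones (c.t1Of x.length t)) ∈ TL}
    have : E = {z | boolPair (yOf c x s z) (ones (c.t1Of x.length t)) ∈ TL}ᶜ := by ext z; simp [hE]
    rw [this, hc]; linarith
  have hcompl := uniformProb_compl L {coins | boolPair (NWPar.inst x t s) coins ∈ lang c TL}
  have hset : {coins | boolPair (NWPar.inst x t s) coins ∉ lang c TL} = {coins | boolPair (NWPar.inst x t s) coins ∈ lang c TL}ᶜ := by
    ext; simp
  rw [hset, hcompl, hacc]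
  have h0 : 0 ≤ uniformProb d E := uniformProb_nonneg _ _
  have hpow : uniformProb d E ^ 7 ≤ (5 / 6 : ℝ) ^ 7 := pow_le_pow_left₀ h0 hE6 7
  linarith [five_sixth_pow_seven_le]

end Facts

end NWSamp

end Literature.Computability.MetaComplexity

end
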